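import Literature.MathematicalPhysics.QuantumLattice.GroundStateSourceWindowBracket
import Literature.MathematicalPhysics.QuantumLattice.LiebRobinsonFnwGapSpectralProofs
import Literature.MathematicalPhysics.QuantumLattice.SpinChainsAkltCorrelationProofs
import Literature.MathematicalPhysics.QuantumLattice.ApproximateEigenvectorLemmas
import Literature.MathematicalPhysics.QuantumLattice.TorusGroundEnergyDensityLimit
import HarnessLib

/-!
# Sub-gap response is bounded by the ground-state fluctuation: the finite-volume converse direction
# «response ⇒ fluctuation» of the Koma–Tasaki dictionary

Venture `CertifiedManyBodySolver`, `Observables/` (cell hubbard-cq = the CUPRATE QUESTION, LADDER-Hubbard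
rows CQ/PC; dictionary row «finite-volume KT-converse» of the transplant lens, DICTIONARY v2 §9, typed there as
`TransplantSketch2.lean` A1–A3; T4-lane use: a certified SOURCED-energy bracket from UNSOURCED certified
data). MODEL-FREE companions of `Literature/…/GroundStateSourceBounds.lean` (the Griffiths / Hellmann–Feynman
chords of the sourced family `H − hO`) with the finite-volume GAP as the extra input; placed venture-side
because the explicit-constant statements below are ours (the mechanism is folklore, see the end of this
docstring), not a printed theorem.
Setting: `H` a Hermitian matrix on a finite index type with a UNIQUE GAPPED ground state
(`Matrix.HasSpectralGap H g`: the ground energy is a simple eigenvalue and every other eigenvalue is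
`≥ E₀ + g`, `0 < g`), `O` Hermitian with vanishing ground-state expectation `Re ω_H(O) = 0` (the symmetric
point), `q := Re ω_H(O·O) = ‖O φ₀‖²` the ground-state FLUCTUATION of `O`, `‖O‖` the operator (`L2Operator`)
norm, and `ω_A` the tracial ground-state functional `Matrix.groundStateFunctional A`.

* `groundEnergy_sub_le_groundEnergy_source_of_hasSpectralGap` (A1, two-level variational bound): for
  `0 ≤ h`, `h‖O‖ < g`,  `E₀(H) − h²q/(g − h‖O‖) ≤ E₀(H − hO)`. Proof: a ground state `ψ` of `H − hO`
  splits as `ψ = αφ₀ + χ`, `χ ⊥ φ₀`; then `⟨ψ,Hψ⟩ ≥ E₀ + g‖χ‖²` (second variational principle,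
  `rayleigh_ge_of_hasSpectralGap_of_orthogonal`) and `⟨ψ,Oψ⟩ ≤ 2√q‖χ‖ + ‖O‖‖χ‖²` (`⟨φ₀,Oφ₀⟩ = 0`,
  Cauchy–Schwarz), and `(g − h‖O‖)s² − 2h√q·s ≥ −h²q/(g − h‖O‖)`.
* `re_groundStateFunctional_source_le_of_hasSpectralGap` (general chord form): for `h < h'`, `0 ≤ h'`,
  `h'‖O‖ < g`,  `Re ω_{H−hO}(O) ≤ h'²q/((h' − h)(g − h'‖O‖))` (concavity chord of `GroundStateSourceBounds` +
  A1 at `h'`), its `h' = 2h` specialisation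
  `re_groundStateFunctional_source_le_fluctuation` (A2):  `Re ω_{H−hO}(O) ≤ 4hq/(g − 2h‖O‖)` for
  `0 < h`, `2h‖O‖ < g` — the sourced RESPONSE below the gap is bounded by the symmetric-point FLUCTUATION —
  and the contrapositive FLOOR form `fluctuation_ge_of_response_floor_of_hasSpectralGap`.

Read contrapositively (a response FLOOR at one sub-gap field forces a fluctuation floor at the symmetric
point) this is the one floor-direction row of the finite-volume Koma–Tasaki dictionary; it is the `T = 0`,
non-perturbative-in-`h` form of the elementary moment bound `χ = 2Σₙ|⟨n|O|0⟩|²/(Eₙ − E₀) ≤ 2q/g`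
(second-order perturbation theory; the `m₋₁ ≤ m₀/ω_min` sum-rule inequality of Pitaevskii–Stringari,
J. Low Temp. Phys. 85 (1991) 377, §2) combined with the convexity of `h ↦ −E₀(H − hO)` (Koma–Tasaki,
J. Stat. Phys. 76 (1994) 745, §1). The modulus that buys the direction is the finite-volume gap `g`, a
TOTAL-energy quantity — so the row has no thermodynamic-limit content by itself (the tree's barrier
`Literature.Barriers.HubbardSuperconductivity.SourcedOrderWithoutGroundStateLRO` is untouched). The WINDOW
forms (density matrices / capped state vectors within `δ` of the sourced ground energy) and the `d`-wave
torus instances (tree units, `O = Δ_d + Δ_d†`, `Re ω_h(O) = 2L²·dWaveSourceDensityTT'`) are in the sequel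
`SubGapResponseFluctuationWindow.lean`.

All statements are finite-dimensional linear algebra ([folklore]; nearest printed forms cited above and in
the docstrings). No definition, no named fact, no `sorry`. Tree search: `lean search
"HasSpectralGap|groundStateFunctional_source|rayleigh_ge_of_hasSpectralGap"` — REUSED:
`rayleigh_ge_of_hasSpectralGap_of_orthogonal` (`LiebRobinsonFnwGapSpectralProofs`),
`groundStateFunctional_eq_of_hasUniqueGroundState` (`SpinChainsAkltCorrelationProofs`), the `eucNorm`
Cauchy–Schwarz API (`ApproximateEigenvectorLemmas`), `exists_unit_groundState_of_isHermitian`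
(`TorusGroundEnergyDensityLimit`), the chords `re_groundStateFunctional_source_mem_Icc` /
`sub_mul_re_groundStateFunctional_le` / `groundEnergy_source_le_of_re_eq_zero` (`GroundStateSourceBounds`);
nothing in the tree or Mathlib bounds a sourced response by the gap and the fluctuation.
-/

noncomputable section

namespace Summit.Ventures.CertifiedManyBodySolver.Observables

open Matrix Literature.MathematicalPhysics.QuantumLattice
open scoped Matrix.Norms.L2Operator ComplexOrder

section ModelFree

variable {n : Type*} [Fintype n] [DecidableEq n]

/-! ### Auxiliary vector identities -/

omit [DecidableEq n] in
/-- `⟨v, w⟩ = conj ⟨w, v⟩` for the `star`-dot product. [folklore] -/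
private theorem star_dotProduct_comm_conj (v w : n → ℂ) :
    star v ⬝ᵥ w = star (star w ⬝ᵥ v) := by
  rw [star_dotProduct]

omit [DecidableEq n] in
/-- For Hermitian `O`: `⟨φ, O w⟩ = ⟨O φ, w⟩`. [folklore] -/
private theorem star_dotProduct_mulVec_of_isHermitian {O : Matrix n n ℂ} (hO : O.IsHermitian)
    (φ w : n → ℂ) : star φ ⬝ᵥ O *ᵥ w = star (O *ᵥ φ) ⬝ᵥ w := by
  rw [star_mulVec, hO.eq, dotProduct_mulVec]

omit [DecidableEq n] in
/-- For Hermitian `O`: `‖O φ‖² = Re ⟨φ, O (O φ)⟩`. [folklore] -/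
private theorem eucNorm_mulVec_sq_of_isHermitian {O : Matrix n n ℂ} (hO : O.IsHermitian)
    (φ : n → ℂ) : eucNorm (O *ᵥ φ) ^ 2 = (star φ ⬝ᵥ (O * O) *ᵥ φ).re := by
  rw [eucNorm_sq, ← mulVec_mulVec, star_dotProduct_mulVec_of_isHermitian hO φ (O *ᵥ φ)]

/-- `Re ⟨χ, O χ⟩ ≤ ‖O‖ · ‖χ‖²` (Cauchy–Schwarz and the operator-norm bound). [folklore] -/
private theorem re_star_dotProduct_mulVec_le_norm_mul (O : Matrix n n ℂ) (χ : n → ℂ) :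
    (star χ ⬝ᵥ O *ᵥ χ).re ≤ ‖O‖ * eucNorm χ ^ 2 := by
  calc (star χ ⬝ᵥ O *ᵥ χ).re ≤ ‖star χ ⬝ᵥ O *ᵥ χ‖ := Complex.re_le_norm _
    _ ≤ eucNorm χ * eucNorm (O *ᵥ χ) := norm_star_dotProduct_le _ _
    _ ≤ eucNorm χ * (‖O‖ * eucNorm χ) :=
        mul_le_mul_of_nonneg_left (eucNorm_mulVec_le O χ) (eucNorm_nonneg _)
    _ = ‖O‖ * eucNorm χ ^ 2 := by ring

/-- A matrix with a spectral gap above a unique ground state lives on a nonempty index type (its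
ground space is one-dimensional). [cite: Tasaki2020, §2.1] -/
theorem nonempty_of_hasSpectralGap {H : Matrix n n ℂ} {g : ℝ} (hgap : H.HasSpectralGap g) :
    Nonempty n := by
  by_contra hne
  rw [not_nonempty_iff] at hne
  have h1 : Module.finrank ℂ H.groundSpace = 1 := hgap.hasUniqueGroundState
  haveI : Subsingleton H.groundSpace := ⟨fun a b => Subtype.ext (Subsingleton.elim _ _)⟩
  have h0 : Module.finrank ℂ H.groundSpace = 0 := Module.finrank_zero_of_subsingleton
  omega

/-- The spectral gap is positive: `H.HasSpectralGap g → 0 < g`. [cite: Tasaki2020, §2.1] -/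
theorem pos_of_hasSpectralGap {H : Matrix n n ℂ} {g : ℝ} (hgap : H.HasSpectralGap g) : 0 < g :=
  ((hgap.isHermitian.hasSpectralGap_iff_card_filter g).1 hgap).1

/-- Under a unique gapped ground state the tracial ground-state functional is the vector state of any
unit ground-state vector: `ω_H(X) = ⟨φ, Xφ⟩`. [cite: Tasaki2020, §2.1] -/
theorem groundStateFunctional_eq_rayleigh_of_hasSpectralGap {H : Matrix n n ℂ} {g : ℝ}
    (hgap : H.HasSpectralGap g) {φ : n → ℂ} (hφ1 : star φ ⬝ᵥ φ = 1)
    (hφ : H *ᵥ φ = (H.groundEnergy : ℂ) • φ) (X : Matrix n n ℂ) :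
    H.groundStateFunctional X = star φ ⬝ᵥ X *ᵥ φ := by
  have hφ0 : φ ≠ 0 := by
    intro h0
    rw [h0, star_zero, zero_dotProduct] at hφ1
    exact zero_ne_one hφ1
  rw [groundStateFunctional_eq_of_hasUniqueGroundState hgap.hasUniqueGroundState
    ((mem_groundSpace_iff H φ).2 hφ) hφ0 X, hφ1, div_one]

/-! ### A1: the two-level variational lower bound on the sourced ground energy -/

/-- The scalar optimisation behind A1: for `0 < a`, `a s² − 2 b s ≥ −b²/a`. [folklore] -/
private theorem quad_lower_bound {a b s : ℝ} (ha : 0 < a) :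
    -(b ^ 2 / a) ≤ a * s ^ 2 - 2 * b * s := by
  have h : a * s ^ 2 - 2 * b * s + b ^ 2 / a = (a * s - b) ^ 2 / a := by
    field_simp
    ring
  have h2 : 0 ≤ (a * s - b) ^ 2 / a := div_nonneg (sq_nonneg _) ha.le
  linarith

/-- **A1 — sub-gap sources cost at most second order in the fluctuation.** Let `H` have a unique
gapped ground state (`H.HasSpectralGap g`), `O` Hermitian with `Re ω_H(O) = 0`, and
`q := Re ω_H(O·O)` (`= ‖Oφ₀‖²`). Then for `0 ≤ h` with `h‖O‖ < g`:
`E₀(H) − h²q/(g − h‖O‖) ≤ E₀(H − hO)`.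
(Two-level variational bound: a ground state `ψ = αφ₀ + χ` of `H − hO`, `χ ⊥ φ₀`, has
`⟨ψ,Hψ⟩ ≥ E₀ + g‖χ‖²` and `⟨ψ,Oψ⟩ ≤ 2√q‖χ‖ + ‖O‖‖χ‖²`.) The `T = 0` form of the elementary
susceptibility bound `χ_O ≤ 2q/g` of second-order perturbation theory / the moment inequality
`m₋₁ ≤ m₀/ω_min`. [folklore] -/
theorem groundEnergy_sub_le_groundEnergy_source_of_hasSpectralGap {H O : Matrix n n ℂ} {g h : ℝ}
    (hgap : H.HasSpectralGap g) (hO : O.IsHermitian) (h0 : (H.groundStateFunctional O).re = 0)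
    (hh : 0 ≤ h) (hhg : h * ‖O‖ < g) :
    H.groundEnergy - h ^ 2 * (H.groundStateFunctional (O * O)).re / (g - h * ‖O‖) ≤
      (H - (h : ℂ) • O).groundEnergy := by
  haveI : Nonempty n := nonempty_of_hasSpectralGap hgap
  have hH : H.IsHermitian := hgap.isHermitian
  have hA : (H - (h : ℂ) • O).IsHermitian := isHermitian_sub_real_smul hH hO h
  -- unit ground-state vectors: `φ` of `H`, `ψ` of `H − hO`
  obtain ⟨φ, hφ1, hφ⟩ := exists_unit_groundState_of_isHermitian hH
  obtain ⟨ψ, hψ1, hψ⟩ := exists_unit_groundState_of_isHermitian hA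
  have hφ0 : φ ≠ 0 := by
    intro h0'
    rw [h0', star_zero, zero_dotProduct] at hφ1
    exact zero_ne_one hφ1
  -- the fluctuation `q = ‖Oφ‖²` and the symmetric point `⟨φ, Oφ⟩ = 0`
  set q : ℝ := (H.groundStateFunctional (O * O)).re with hq_def
  have hq : eucNorm (O *ᵥ φ) ^ 2 = q := by
    rw [hq_def, groundStateFunctional_eq_rayleigh_of_hasSpectralGap hgap hφ1 hφ (O * O),
      eucNorm_mulVec_sq_of_isHermitian hO]
  have hq0 : 0 ≤ q := by rw [← hq]; positivity
  have hφO : (star φ ⬝ᵥ O *ᵥ φ).re = 0 := by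
    rw [← groundStateFunctional_eq_rayleigh_of_hasSpectralGap hgap hφ1 hφ O, h0]
  -- decomposition `ψ = α φ + χ`, `χ ⊥ φ`
  set α : ℂ := star φ ⬝ᵥ ψ with hα_def
  set χ : n → ℂ := ψ - α • φ with hχ_def
  have hψeq : ψ = α • φ + χ := by rw [hχ_def]; abel
  have horth : star φ ⬝ᵥ χ = 0 := by
    rw [hχ_def, dotProduct_sub, dotProduct_smul, hφ1, smul_eq_mul, mul_one, ← hα_def, sub_self]
  have horth' : star χ ⬝ᵥ φ = 0 := by
    rw [star_dotProduct_comm_conj, horth, star_zero]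
  -- `H`-expectation: `⟨ψ,Hψ⟩ = |α|² E₀ + ⟨χ,Hχ⟩`
  have hHφχ : star φ ⬝ᵥ H *ᵥ χ = 0 := by
    rw [star_dotProduct_mulVec_of_isHermitian hH, hφ, star_smul, smul_dotProduct, horth, smul_zero]
  have hHχφ : star χ ⬝ᵥ H *ᵥ φ = 0 := by
    rw [hφ, dotProduct_smul, horth', smul_zero]
  set T : ℝ := (star χ ⬝ᵥ χ).re with hT_def
  have hT0 : 0 ≤ T := by
    rw [hT_def, ← eucNorm_sq]; positivity
  have hTχ : eucNorm χ ^ 2 = T := by rw [hT_def, eucNorm_sq]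
  -- norm identity `1 = |α|² + T`
  have hnormC : (1 : ℂ) = α * star α + star χ ⬝ᵥ χ := by
    rw [← hψ1]
    conv_lhs => rw [hψeq]
    simp only [star_add, star_smul, add_dotProduct, smul_dotProduct, dotProduct_add, dotProduct_smul,
      hφ1, horth, horth', smul_eq_mul, mul_one, mul_zero, add_zero, zero_add]
  have hnorm : 1 = Complex.normSq α + T := by
    have := congrArg Complex.re hnormC
    rw [Complex.one_re, Complex.add_re, Complex.mul_re, Complex.star_def, Complex.conj_re,
      Complex.conj_im] at this
    rw [this, hT_def, Complex.normSq_apply]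
    ring
  have hαle : Complex.normSq α ≤ 1 := by linarith
  have hT1 : T ≤ 1 := by nlinarith [Complex.normSq_nonneg α]
  -- `Re⟨ψ,Hψ⟩ = (1 - T) E₀ + Re⟨χ,Hχ⟩ ≥ E₀ + g T`
  have hHexp : star ψ ⬝ᵥ H *ᵥ ψ = α * star α * (H.groundEnergy : ℂ) + star χ ⬝ᵥ H *ᵥ χ := by
    conv_lhs => rw [hψeq]
    simp only [star_add, star_smul, mulVec_add, mulVec_smul, add_dotProduct, smul_dotProduct,
      dotProduct_add, dotProduct_smul, hHφχ, hφ, hφ1, horth', smul_eq_mul, mul_one, mul_zero,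
      add_zero, zero_add]
    ring
  have hgapχ : (H.groundEnergy + g) * T ≤ (star χ ⬝ᵥ H *ᵥ χ).re :=
    rayleigh_ge_of_hasSpectralGap_of_orthogonal hgap hφ0 hφ horth
  have hHre : H.groundEnergy + g * T ≤ (star ψ ⬝ᵥ H *ᵥ ψ).re := by
    have hre : (star ψ ⬝ᵥ H *ᵥ ψ).re = Complex.normSq α * H.groundEnergy + (star χ ⬝ᵥ H *ᵥ χ).re := by
      rw [hHexp, Complex.add_re]
      congr 1
      rw [Complex.re_mul_ofReal, Complex.mul_re, Complex.star_def, Complex.conj_re, Complex.conj_im,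
        Complex.normSq_apply]
      ring
    rw [hre]
    have : Complex.normSq α = 1 - T := by linarith
    rw [this]
    nlinarith
  -- `Re⟨ψ,Oψ⟩ ≤ 2 √q √T + ‖O‖ T`
  have hOexp : star ψ ⬝ᵥ O *ᵥ ψ =
      α * star α * (star φ ⬝ᵥ O *ᵥ φ) + (star α * (star φ ⬝ᵥ O *ᵥ χ) +
        α * (star χ ⬝ᵥ O *ᵥ φ)) + star χ ⬝ᵥ O *ᵥ χ := by
    conv_lhs => rw [hψeq]
    simp only [star_add, star_smul, mulVec_add, mulVec_smul, add_dotProduct, smul_dotProduct,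
      dotProduct_add, dotProduct_smul, smul_eq_mul]
    ring
  have hcross : star χ ⬝ᵥ O *ᵥ φ = star (star φ ⬝ᵥ O *ᵥ χ) := by
    rw [star_dotProduct_mulVec_of_isHermitian hO φ χ]
    exact star_dotProduct_comm_conj χ (O *ᵥ φ)
  have hcs : ‖star φ ⬝ᵥ O *ᵥ χ‖ ≤ Real.sqrt q * Real.sqrt T := by
    rw [star_dotProduct_mulVec_of_isHermitian hO]
    calc ‖star (O *ᵥ φ) ⬝ᵥ χ‖ ≤ eucNorm (O *ᵥ φ) * eucNorm χ := norm_star_dotProduct_le _ _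
      _ = Real.sqrt q * Real.sqrt T := by
          rw [← hq, ← hTχ, Real.sqrt_sq (eucNorm_nonneg _), Real.sqrt_sq (eucNorm_nonneg _)]
  have hαnorm : ‖α‖ ≤ 1 := by
    have : ‖α‖ ^ 2 ≤ 1 := by rw [Complex.sq_norm]; exact hαle
    nlinarith [norm_nonneg α]
  have hOre : (star ψ ⬝ᵥ O *ᵥ ψ).re ≤ 2 * (Real.sqrt q * Real.sqrt T) + ‖O‖ * T := by
    rw [hOexp, Complex.add_re, Complex.add_re]
    have h1 : (α * star α * (star φ ⬝ᵥ O *ᵥ φ)).re = 0 := by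
      have hreal : α * star α = (Complex.normSq α : ℂ) := by
        rw [Complex.star_def, Complex.mul_conj]
      rw [hreal, Complex.re_ofReal_mul, hφO, mul_zero]
    have h2 : (star α * (star φ ⬝ᵥ O *ᵥ χ) + α * (star χ ⬝ᵥ O *ᵥ φ)).re ≤
        2 * (Real.sqrt q * Real.sqrt T) := by
      rw [hcross]
      have : star α * (star φ ⬝ᵥ O *ᵥ χ) + α * star (star φ ⬝ᵥ O *ᵥ χ) =
          star α * (star φ ⬝ᵥ O *ᵥ χ) + star (star α * (star φ ⬝ᵥ O *ᵥ χ)) := by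
        rw [star_mul', star_star]
      rw [this, Complex.add_re, Complex.star_def, Complex.conj_re, ← two_mul]
      refine mul_le_mul_of_nonneg_left ?_ (by norm_num)
      calc (star α * (star φ ⬝ᵥ O *ᵥ χ)).re ≤ ‖star α * (star φ ⬝ᵥ O *ᵥ χ)‖ := Complex.re_le_norm _
        _ = ‖α‖ * ‖star φ ⬝ᵥ O *ᵥ χ‖ := by rw [norm_mul, norm_star]
        _ ≤ 1 * (Real.sqrt q * Real.sqrt T) :=
            mul_le_mul hαnorm hcs (norm_nonneg _) zero_le_one
        _ = Real.sqrt q * Real.sqrt T := one_mul _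
    have h3 : (star χ ⬝ᵥ O *ᵥ χ).re ≤ ‖O‖ * T := by
      rw [← hTχ]; exact re_star_dotProduct_mulVec_le_norm_mul O χ
    linarith
  -- assemble: `E₀(H − hO) = Re⟨ψ,Hψ⟩ − h Re⟨ψ,Oψ⟩`
  have hE : (H - (h : ℂ) • O).groundEnergy = (star ψ ⬝ᵥ H *ᵥ ψ).re - h * (star ψ ⬝ᵥ O *ᵥ ψ).re := by
    have := re_rayleigh_of_eigenvector hψ1 hψ
    rw [← this, sub_mulVec, smul_mulVec, dotProduct_sub, dotProduct_smul, Complex.sub_re, smul_eq_mul,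
      Complex.re_ofReal_mul]
  set s : ℝ := Real.sqrt T with hs_def
  have hs0 : 0 ≤ s := Real.sqrt_nonneg _
  have hsT : s ^ 2 = T := Real.sq_sqrt hT0
  have hsq : Real.sqrt q ^ 2 = q := Real.sq_sqrt hq0
  have ha : 0 < g - h * ‖O‖ := sub_pos.2 hhg
  have key := quad_lower_bound (b := h * Real.sqrt q) (s := s) ha
  have hb2 : (h * Real.sqrt q) ^ 2 = h ^ 2 * q := by rw [mul_pow, hsq]
  rw [hb2] at key
  rw [hE]
  have hmain : H.groundEnergy + g * T - h * (2 * (Real.sqrt q * s) + ‖O‖ * T) ≤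
      (star ψ ⬝ᵥ H *ᵥ ψ).re - h * (star ψ ⬝ᵥ O *ᵥ ψ).re := by
    have := mul_le_mul_of_nonneg_left hOre hh
    linarith
  calc H.groundEnergy - h ^ 2 * q / (g - h * ‖O‖)
      ≤ H.groundEnergy + ((g - h * ‖O‖) * s ^ 2 - 2 * (h * Real.sqrt q) * s) := by linarith
    _ = H.groundEnergy + g * T - h * (2 * (Real.sqrt q * s) + ‖O‖ * T) := by rw [← hsT]; ring
    _ ≤ _ := hmain

/-- A1, gain form: the ENERGY GAIN `G(h) := E₀(H) − E₀(H − hO)` of a sub-gap source is at most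
`h²q/(g − h‖O‖)` (and it is `≥ 0` by `groundEnergy_source_le_of_re_eq_zero`). [folklore] -/
theorem groundEnergy_sub_groundEnergy_source_le_of_hasSpectralGap {H O : Matrix n n ℂ} {g h : ℝ}
    (hgap : H.HasSpectralGap g) (hO : O.IsHermitian) (h0 : (H.groundStateFunctional O).re = 0)
    (hh : 0 ≤ h) (hhg : h * ‖O‖ < g) :
    H.groundEnergy - (H - (h : ℂ) • O).groundEnergy ≤
      h ^ 2 * (H.groundStateFunctional (O * O)).re / (g - h * ‖O‖) := by
  have := groundEnergy_sub_le_groundEnergy_source_of_hasSpectralGap hgap hO h0 hh hhg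
  linarith

/-! ### A2: the sourced response below the gap is bounded by the fluctuation -/

/-- **General chord form.** Under `H.HasSpectralGap g`, `O` Hermitian, `Re ω_H(O) = 0`, for sources
`h < h'` with `0 ≤ h'` and `h'‖O‖ < g`:
`Re ω_{H−hO}(O) ≤ h'²q/((h' − h)(g − h'‖O‖))`, `q = Re ω_H(O·O)`
(the concavity chord `(h' − h)·Re ω_h(O) ≤ E₀(H − hO) − E₀(H − h'O)` of Griffiths / Koma–Tasaki,
`E₀(H − hO) ≤ E₀(H)`, and A1 at `h'`). [cite: KomaTasaki1994, §1] -/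
theorem re_groundStateFunctional_source_le_of_hasSpectralGap {H O : Matrix n n ℂ} {g h h' : ℝ}
    (hgap : H.HasSpectralGap g) (hO : O.IsHermitian) (h0 : (H.groundStateFunctional O).re = 0)
    (hhh' : h < h') (hh' : 0 ≤ h') (hh'g : h' * ‖O‖ < g) :
    ((H - (h : ℂ) • O).groundStateFunctional O).re ≤
      h' ^ 2 * (H.groundStateFunctional (O * O)).re / ((h' - h) * (g - h' * ‖O‖)) := by
  haveI : Nonempty n := nonempty_of_hasSpectralGap hgap
  have hH : H.IsHermitian := hgap.isHermitian
  have hchord := sub_mul_re_groundStateFunctional_le hH hO h h'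
  have hup : (H - (h : ℂ) • O).groundEnergy ≤ H.groundEnergy :=
    groundEnergy_source_le_of_re_eq_zero hH hO h0 h
  have hA1 := groundEnergy_sub_le_groundEnergy_source_of_hasSpectralGap hgap hO h0 hh' hh'g
  have hδ : 0 < h' - h := sub_pos.2 hhh'
  have hg' : 0 < g - h' * ‖O‖ := sub_pos.2 hh'g
  rw [le_div_iff₀ (mul_pos hδ hg')]
  have h3 : (h' - h) * ((H - (h : ℂ) • O).groundStateFunctional O).re ≤
      h' ^ 2 * (H.groundStateFunctional (O * O)).re / (g - h' * ‖O‖) := by linarith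
  calc ((H - (h : ℂ) • O).groundStateFunctional O).re * ((h' - h) * (g - h' * ‖O‖))
      = (h' - h) * ((H - (h : ℂ) • O).groundStateFunctional O).re * (g - h' * ‖O‖) := by ring
    _ ≤ h' ^ 2 * (H.groundStateFunctional (O * O)).re / (g - h' * ‖O‖) * (g - h' * ‖O‖) :=
        mul_le_mul_of_nonneg_right h3 hg'.le
    _ = h' ^ 2 * (H.groundStateFunctional (O * O)).re := div_mul_cancel₀ _ hg'.ne'

/-- **A2 — sub-gap response ≤ fluctuation.** Under `H.HasSpectralGap g`, `O` Hermitian,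
`Re ω_H(O) = 0`, `q = Re ω_H(O·O)`: for `0 < h` with `2h‖O‖ < g`,
`Re ω_{H−hO}(O) ≤ 4hq/(g − 2h‖O‖)`
(the `h' = 2h` chord). The response to a SUB-GAP source is bounded by the symmetric-point fluctuation
— the `T = 0`, finite-`h` form of `(O,O)_Duhamel ≤ ⟨O²⟩` / `χ ≤ 2q/g`. [cite: KomaTasaki1994, §1] -/
theorem re_groundStateFunctional_source_le_fluctuation {H O : Matrix n n ℂ} {g h : ℝ}
    (hgap : H.HasSpectralGap g) (hO : O.IsHermitian) (h0 : (H.groundStateFunctional O).re = 0)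
    (hh : 0 < h) (hhg : 2 * h * ‖O‖ < g) :
    ((H - (h : ℂ) • O).groundStateFunctional O).re ≤
      4 * h * (H.groundStateFunctional (O * O)).re / (g - 2 * h * ‖O‖) := by
  have key := re_groundStateFunctional_source_le_of_hasSpectralGap hgap hO h0
    (show h < 2 * h by linarith) (by linarith) hhg
  have hg : g - 2 * h * ‖O‖ ≠ 0 := (sub_pos.2 hhg).ne'
  calc ((H - (h : ℂ) • O).groundStateFunctional O).re
      ≤ (2 * h) ^ 2 * (H.groundStateFunctional (O * O)).re / ((2 * h - h) * (g - 2 * h * ‖O‖)) := key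
    _ = 4 * h * (H.groundStateFunctional (O * O)).re / (g - 2 * h * ‖O‖) := by
        field_simp
        ring

/-- **A2, contrapositive (floor) form**: a response FLOOR `m ≤ Re ω_{H−hO}(O)` at one sub-gap source
forces the fluctuation floor `m·(g − 2h‖O‖)/(4h) ≤ q` at the symmetric point. [cite: KomaTasaki1994, §1] -/
theorem fluctuation_ge_of_response_floor_of_hasSpectralGap {H O : Matrix n n ℂ} {g h m : ℝ}
    (hgap : H.HasSpectralGap g) (hO : O.IsHermitian) (h0 : (H.groundStateFunctional O).re = 0)
    (hh : 0 < h) (hhg : 2 * h * ‖O‖ < g) (hm : m ≤ ((H - (h : ℂ) • O).groundStateFunctional O).re) :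
    m * (g - 2 * h * ‖O‖) / (4 * h) ≤ (H.groundStateFunctional (O * O)).re := by
  have key := hm.trans (re_groundStateFunctional_source_le_fluctuation hgap hO h0 hh hhg)
  have hg : 0 < g - 2 * h * ‖O‖ := sub_pos.2 hhg
  have h4 : (0 : ℝ) < 4 * h := by linarith
  rw [div_le_iff₀ h4]
  rw [le_div_iff₀ hg] at key
  linarith

end ModelFree

end Summit.Ventures.CertifiedManyBodySolver.Observables

end
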